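import Summits.RiemannHypothesis.RiemannHypothesis.Theorems.PfPersistenceRatioShortWindowSettled
import Summits.RiemannHypothesis.RiemannHypothesis.Theorems.PfPersistenceRatioGuardedIsolation
import HarnessLib

/-!
# Rigid-window persistence — the FAR-GUARDED ratio readers (window floor `a ≥ a_min`)

Leaf G1.21b of the CASE-DAG (the `(Z)`-cell of the §6 PINCER): the sign-blind RATIO conjuncts
`|ε₁| ≤ τ(ε₂ − ε₁)` (gauge) and `|ε₁| ≤ κ|ε₂|` (modulus).  Every `∀`-window version of these readers is
`ζ`-free by theorem (`PfPersistenceRatioUnguardedSettled`: the degenerate windows `N = 0`;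
`PfPersistenceRatioShortWindowSettled`: the short windows `(a, 1)`, where `ζ`'s block is `log(1/a)·𝟙 + O(1)`).
The honest remaining object therefore carries a WINDOW FLOOR: this file types it and transfers the leaf's
theorems to it.  Everything is RH-free; nothing is asserted about `ζ`'s values at far windows (those are DATA).

* §1 `GaugeRatioClassFar a_min τ := {d | ∀ win, a_min ≤ win.a → 0 < win.N → d ∈ gaugeRatioAt τ win}` and the
  modulus twin; inclusions (`GaugeRatioClassPos τ ⊆ GaugeRatioClassFar a_min τ`, monotone in the floor, equal to
  the guarded class for a non-positive floor).
* §2 THE FLOOR IS NECESSARY: for every `τ` (resp. `κ < 1`) there is `a₁ > 0` such that every floor `a_min ≤ a₁`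
  still excludes `ζ` and every origin-free datum (`exists_floor_zeta_not_mem_gaugeRatioClassFar`, …).
* §3 DIAL ISOLATION TRANSFERS: a binder window that REACHES the prime `q` (`q ∈ primeRange (2a)`) has
  `a ≥ (log q)/2`, so the cluster-binder packages (`ClusterBinders`, `ClusterReady`, …) isolate `ζ` from its
  `q`-dials inside the far-guarded classes for every floor `a_min ≤ (log q)/2` — in particular for the floor of
  record `3/10 < (log 2)/2` and EVERY prime (`three_tenths_le_half_log`).
* §4 SOUNDNESS AND THE ZERO-SIDE READING TRANSFER: a deep negative direction under a low plane at ONE far window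
  refutes membership; `ζ ∈ GaugeRatioClassFar a_min τ` (`0 ≤ τ < 1`) ⇒ `ε₂(ζ; w) ≥ 0` at every far window of
  dimension `≥ 2` ⇒ the off-line zero quadrant is infinite or has at most one element (the Galerkin negative-index
  readings only need LONG windows, `PfPersistenceGalerkinNegIndex`).  Premise NOT asserted; conclusion sub-RH.

[folklore] throughout (bookkeeping over the cited tree theorems). Mechanism/rigidity campaign; no RH claims.
-/

set_option linter.dupNamespace false

noncomputable section

namespace Summit.RiemannHypothesis.RiemannHypothesis.Theorems.PfPersistence

open Real Set Matrix
open Literature.NumberTheory.LFunctions Literature.NumberTheory.LFunctions.ZetaZeros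
open Summit.RiemannHypothesis.RiemannHypothesis.Theorems.PfPersistenceM2NegIndex

/-! ## §1 The far-guarded classes -/

/-- The FAR-GUARDED gauge-ratio class with window floor `a_min`: the gauge conjunct is imposed only at windows
with `a_min ≤ a` and `0 < N`. [folklore] -/
def GaugeRatioClassFar (amin τ : ℝ) : Set Datum :=
  {d | ∀ win : Window, amin ≤ win.a → 0 < win.N → d ∈ gaugeRatioAt τ win}

/-- The FAR-GUARDED modulus-ratio class with window floor `a_min`. [folklore] -/
def ModulusRatioClassFar (amin κ : ℝ) : Set Datum :=
  {d | ∀ win : Window, amin ≤ win.a → 0 < win.N → d ∈ modulusRatioAt κ win}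

/-- PROVED: the guarded class lies inside every far-guarded class. [folklore] -/
theorem gaugeRatioClassPos_subset_far (amin τ : ℝ) : GaugeRatioClassPos τ ⊆ GaugeRatioClassFar amin τ :=
  fun _ h win _ hN => h win hN

/-- PROVED: modulus twin. [folklore] -/
theorem modulusRatioClassPos_subset_far (amin κ : ℝ) : ModulusRatioClassPos κ ⊆ ModulusRatioClassFar amin κ :=
  fun _ h win _ hN => h win hN

/-- PROVED: raising the floor enlarges the class. [folklore] -/
theorem gaugeRatioClassFar_mono {amin amin' : ℝ} (h : amin ≤ amin') (τ : ℝ) :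
    GaugeRatioClassFar amin τ ⊆ GaugeRatioClassFar amin' τ :=
  fun _ hd win hwin hN => hd win (h.trans hwin) hN

/-- PROVED: modulus twin. [folklore] -/
theorem modulusRatioClassFar_mono {amin amin' : ℝ} (h : amin ≤ amin') (κ : ℝ) :
    ModulusRatioClassFar amin κ ⊆ ModulusRatioClassFar amin' κ :=
  fun _ hd win hwin hN => hd win (h.trans hwin) hN

/-- PROVED: a non-positive floor is no floor — the class is the guarded class. [folklore] -/
theorem gaugeRatioClassFar_eq_pos_of_nonpos {amin : ℝ} (h : amin ≤ 0) (τ : ℝ) :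
    GaugeRatioClassFar amin τ = GaugeRatioClassPos τ :=
  Subset.antisymm (fun _ hd win hN => hd win (h.trans win.ha.le) hN) (gaugeRatioClassPos_subset_far amin τ)

/-- PROVED: modulus twin. [folklore] -/
theorem modulusRatioClassFar_eq_pos_of_nonpos {amin : ℝ} (h : amin ≤ 0) (κ : ℝ) :
    ModulusRatioClassFar amin κ = ModulusRatioClassPos κ :=
  Subset.antisymm (fun _ hd win hN => hd win (h.trans win.ha.le) hN) (modulusRatioClassPos_subset_far amin κ)

/-! ## §2 The floor is necessary: short floors still exclude `ζ` -/

/-- **PROVED — SHORT FLOORS STILL EXCLUDE `ζ` (gauge, every `τ`)**: below the depth `a₁(τ)` of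
`exists_shortWindow_not_mem_gaugeRatioAt` the window `(a₁, 1)` is admissible and rejects `ζ`. [folklore] -/
theorem exists_floor_zeta_not_mem_gaugeRatioClassFar (τ : ℝ) :
    ∃ a₁ : ℝ, 0 < a₁ ∧ a₁ ≤ 1 / 5 ∧ ∀ amin : ℝ, amin ≤ a₁ → zetaDatum ∉ GaugeRatioClassFar amin τ := by
  obtain ⟨a₁, ha₁, h5, H⟩ := exists_shortWindow_not_mem_gaugeRatioAt τ
  exact ⟨a₁, ha₁, h5, fun amin hle hmem => H a₁ ha₁ le_rfl zetaDatum rfl (hmem ⟨a₁, 1, ha₁⟩ hle Nat.one_pos)⟩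

/-- **PROVED — SHORT FLOORS STILL EXCLUDE `ζ` (modulus, `κ < 1`).** [folklore] -/
theorem exists_floor_zeta_not_mem_modulusRatioClassFar {κ : ℝ} (hκ : κ < 1) :
    ∃ a₁ : ℝ, 0 < a₁ ∧ a₁ ≤ 1 / 5 ∧ ∀ amin : ℝ, amin ≤ a₁ → zetaDatum ∉ ModulusRatioClassFar amin κ := by
  obtain ⟨a₁, ha₁, h5, H⟩ := exists_shortWindow_not_mem_modulusRatioAt hκ
  exact ⟨a₁, ha₁, h5, fun amin hle hmem => H a₁ ha₁ le_rfl zetaDatum rfl (hmem ⟨a₁, 1, ha₁⟩ hle Nat.one_pos)⟩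

/-- PROVED: and they exclude every origin-free datum (no prime below `e^{2a₁} < 2`). [folklore] -/
theorem exists_floor_datumOf_not_mem_gaugeRatioClassFar_of_originFree (τ : ℝ) :
    ∃ a₁ : ℝ, 0 < a₁ ∧ a₁ ≤ 1 / 5 ∧ ∀ amin : ℝ, amin ≤ a₁ →
      ∀ w : ℕ → ℝ, w ∈ originFreeWeights → datumOf w ∉ GaugeRatioClassFar amin τ := by
  obtain ⟨a₁, ha₁, h5, H⟩ := exists_shortWindow_not_mem_gaugeRatioAt τ
  exact ⟨a₁, ha₁, h5, fun amin hle w hw hmem => H a₁ ha₁ le_rfl (datumOf w)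
    (datumOf_apply_eq_zeta_of_originFree hw ha₁ h5) (hmem ⟨a₁, 1, ha₁⟩ hle Nat.one_pos)⟩

/-- PROVED: modulus twin. [folklore] -/
theorem exists_floor_datumOf_not_mem_modulusRatioClassFar_of_originFree {κ : ℝ} (hκ : κ < 1) :
    ∃ a₁ : ℝ, 0 < a₁ ∧ a₁ ≤ 1 / 5 ∧ ∀ amin : ℝ, amin ≤ a₁ →
      ∀ w : ℕ → ℝ, w ∈ originFreeWeights → datumOf w ∉ ModulusRatioClassFar amin κ := by
  obtain ⟨a₁, ha₁, h5, H⟩ := exists_shortWindow_not_mem_modulusRatioAt hκ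
  exact ⟨a₁, ha₁, h5, fun amin hle w hw hmem => H a₁ ha₁ le_rfl (datumOf w)
    (datumOf_apply_eq_zeta_of_originFree hw ha₁ h5) (hmem ⟨a₁, 1, ha₁⟩ hle Nat.one_pos)⟩

/-! ## §3 Dial isolation transfers: reaching `q` forces `a ≥ (log q)/2` -/

/-- PROVED: a window reaching the prime `q` is at least `(log q)/2` long. [folklore] -/
theorem half_log_le_of_mem_primeRange {q : ℕ} {win : Window} (hq : q ∈ primeRange (2 * win.a)) :
    Real.log q / 2 ≤ win.a := by
  have h := log_le_of_mem_primeRange (by linarith [win.ha]) hq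
  linarith

/-- PROVED: the floor of record `3/10` lies below `(log q)/2` for EVERY `q ≥ 2`. [folklore] -/
theorem three_tenths_le_half_log {q : ℕ} (hq : 2 ≤ q) : (3 : ℝ) / 10 ≤ Real.log q / 2 := by
  have h2 : Real.log 2 ≤ Real.log q := Real.log_le_log two_pos (by exact_mod_cast hq)
  linarith [Real.log_two_gt_d9]

/-- PROVED: binder windows of a `ClusterBinders` package satisfy every floor `≤ (log q)/2`. [folklore] -/
theorem ClusterBinders.floor_le {q : ℕ} {W : ℕ → Window} {ρ C : ℝ} (hB : ClusterBinders q W ρ C) {amin : ℝ}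
    (hamin : amin ≤ Real.log q / 2) (n : ℕ) : amin ≤ (W n).a :=
  hamin.trans (half_log_le_of_mem_primeRange (hB.reaches n))

/-- PROVED: same for the negative package. [folklore] -/
theorem ClusterBindersNeg.floor_le {q : ℕ} {W : ℕ → Window} {ρ C : ℝ} (hB : ClusterBindersNeg q W ρ C)
    {amin : ℝ} (hamin : amin ≤ Real.log q / 2) (n : ℕ) : amin ≤ (W n).a :=
  hamin.trans (half_log_le_of_mem_primeRange (hB.reaches n))

/-- **PROVED — UP-DIAL ISOLATION IN `GaugeRatioClassFar a_min τ`** modulo `ClusterBinders q W ρ C`, for every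
floor `a_min ≤ (log q)/2` (`0 ≤ τ < 1`, `τC < ρ(1 − τ)`). [folklore] -/
theorem upDial_not_mem_gaugeRatioClassFar {q : ℕ} {W : ℕ → Window} {ρ C : ℝ} (hB : ClusterBinders q W ρ C)
    {amin : ℝ} (hamin : amin ≤ Real.log q / 2) {τ : ℝ} (hτ0 : 0 ≤ τ) (hτ : τ < 1) (hρ : τ * C < ρ * (1 - τ))
    {K : ℝ} (ht : 0 < 2 * (K - 1) * zetaWeights q) : datumOf (dial q K zetaWeights) ∉ GaugeRatioClassFar amin τ := by
  obtain ⟨n, hN, hn⟩ := exists_upDial_not_mem_gaugeRatioAt_pos hB hτ0 hτ hρ ht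
  exact fun h => hn (h (W n) (hB.floor_le hamin n) hN)

/-- PROVED: down-dial isolation in `GaugeRatioClassFar a_min τ` modulo `ClusterBindersNeg`. [folklore] -/
theorem downDial_not_mem_gaugeRatioClassFar {q : ℕ} {W : ℕ → Window} {ρ C : ℝ} (hB : ClusterBindersNeg q W ρ C)
    {amin : ℝ} (hamin : amin ≤ Real.log q / 2) {τ : ℝ} (hτ0 : 0 ≤ τ) (hτ : τ < 1) (hρ : τ * C < ρ * (1 - τ))
    {K : ℝ} (ht : 2 * (K - 1) * zetaWeights q < 0) : datumOf (dial q K zetaWeights) ∉ GaugeRatioClassFar amin τ := by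
  obtain ⟨n, hN, hn⟩ := exists_downDial_not_mem_gaugeRatioAt_pos hB hτ0 hτ hρ ht
  exact fun h => hn (h (W n) (hB.floor_le hamin n) hN)

/-- PROVED: modulus, up-dials (`0 ≤ κ < 1`, `κC < ρ`). [folklore] -/
theorem upDial_not_mem_modulusRatioClassFar {q : ℕ} {W : ℕ → Window} {ρ C : ℝ} (hB : ClusterBinders q W ρ C)
    {amin : ℝ} (hamin : amin ≤ Real.log q / 2) {κ : ℝ} (hκ0 : 0 ≤ κ) (hκ : κ < 1) (hκC : κ * C < ρ) {K : ℝ}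
    (ht : 0 < 2 * (K - 1) * zetaWeights q) : datumOf (dial q K zetaWeights) ∉ ModulusRatioClassFar amin κ := by
  obtain ⟨n, hN, hn⟩ := exists_upDial_not_mem_modulusRatioAt_pos hB hκ0 hκ hκC ht
  exact fun h => hn (h (W n) (hB.floor_le hamin n) hN)

/-- PROVED: modulus, down-dials. [folklore] -/
theorem downDial_not_mem_modulusRatioClassFar {q : ℕ} {W : ℕ → Window} {ρ C : ℝ}
    (hB : ClusterBindersNeg q W ρ C) {amin : ℝ} (hamin : amin ≤ Real.log q / 2) {κ : ℝ} (hκ0 : 0 ≤ κ)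
    (hκ : κ < 1) (hκC : κ * C < ρ) {K : ℝ} (ht : 2 * (K - 1) * zetaWeights q < 0) :
    datumOf (dial q K zetaWeights) ∉ ModulusRatioClassFar amin κ := by
  obtain ⟨n, hN, hn⟩ := exists_downDial_not_mem_modulusRatioAt_pos hB hκ0 hκ hκC ht
  exact fun h => hn (h (W n) (hB.floor_le hamin n) hN)

/-- **PROVED — `∃`-window idiom: up-dial isolation in the far-guarded gauge class modulo `ClusterReady q ρ` ONLY**
(floor `a_min ≤ (log q)/2`; `τ(1 + ρ) < ρ`; the cap `C = 1` is free). [folklore] -/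
theorem upDial_not_mem_gaugeRatioClassFar_of_clusterReady {q : ℕ} {ρ : ℝ} (h : ClusterReady q ρ) {amin : ℝ}
    (hamin : amin ≤ Real.log q / 2) {τ : ℝ} (hτ0 : 0 ≤ τ) (hτ : τ < 1) (hτρ : τ * (1 + ρ) < ρ) {K : ℝ}
    (ht : 0 < 2 * (K - 1) * zetaWeights q) : datumOf (dial q K zetaWeights) ∉ GaugeRatioClassFar amin τ := by
  obtain ⟨W, hW⟩ := h.exists_clusterBindersLight
  exact upDial_not_mem_gaugeRatioClassFar hW.toClusterBinders hamin hτ0 hτ (by linarith) ht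

/-- PROVED: down-dial twin modulo `ClusterReadyNeg q ρ`. [folklore] -/
theorem downDial_not_mem_gaugeRatioClassFar_of_clusterReadyNeg {q : ℕ} {ρ : ℝ} (h : ClusterReadyNeg q ρ)
    {amin : ℝ} (hamin : amin ≤ Real.log q / 2) {τ : ℝ} (hτ0 : 0 ≤ τ) (hτ : τ < 1) (hτρ : τ * (1 + ρ) < ρ)
    {K : ℝ} (ht : 2 * (K - 1) * zetaWeights q < 0) : datumOf (dial q K zetaWeights) ∉ GaugeRatioClassFar amin τ := by
  obtain ⟨W, hW⟩ := h.exists_clusterBindersNegLight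
  exact downDial_not_mem_gaugeRatioClassFar hW.toClusterBindersNeg hamin hτ0 hτ (by linarith) ht

/-- **PROVED — both packages ⇒ the only `q`-dial of `ζ` in the far-guarded gauge class is the trivial one.**
[folklore] -/
theorem dial_mem_gaugeRatioClassFar_imp_trivial_of_clusterReady {q : ℕ} {ρ ρ' : ℝ} (h : ClusterReady q ρ)
    (h' : ClusterReadyNeg q ρ') {amin : ℝ} (hamin : amin ≤ Real.log q / 2) {τ : ℝ} (hτ0 : 0 ≤ τ) (hτ : τ < 1)
    (hτρ : τ * (1 + ρ) < ρ) (hτρ' : τ * (1 + ρ') < ρ') {K : ℝ}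
    (hmem : datumOf (dial q K zetaWeights) ∈ GaugeRatioClassFar amin τ) : (K - 1) * zetaWeights q = 0 := by
  by_contra hne
  rcases lt_or_gt_of_ne hne with hlt | hgt
  · exact downDial_not_mem_gaugeRatioClassFar_of_clusterReadyNeg h' hamin hτ0 hτ hτρ' (K := K) (by linarith) hmem
  · exact upDial_not_mem_gaugeRatioClassFar_of_clusterReady h hamin hτ0 hτ hτρ (K := K) (by linarith) hmem

/-- PROVED: modulus, up-dials modulo `ClusterReady q ρ` only (`κ < ρ`). [folklore] -/
theorem upDial_not_mem_modulusRatioClassFar_of_clusterReady {q : ℕ} {ρ : ℝ} (h : ClusterReady q ρ) {amin : ℝ}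
    (hamin : amin ≤ Real.log q / 2) {κ : ℝ} (hκ0 : 0 ≤ κ) (hκ : κ < 1) (hκρ : κ < ρ) {K : ℝ}
    (ht : 0 < 2 * (K - 1) * zetaWeights q) : datumOf (dial q K zetaWeights) ∉ ModulusRatioClassFar amin κ := by
  obtain ⟨W, hW⟩ := h.exists_clusterBindersLight
  exact upDial_not_mem_modulusRatioClassFar hW.toClusterBinders hamin hκ0 hκ (by linarith) ht

/-- PROVED: modulus, down-dials modulo `ClusterReadyNeg q ρ` only. [folklore] -/
theorem downDial_not_mem_modulusRatioClassFar_of_clusterReadyNeg {q : ℕ} {ρ : ℝ} (h : ClusterReadyNeg q ρ)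
    {amin : ℝ} (hamin : amin ≤ Real.log q / 2) {κ : ℝ} (hκ0 : 0 ≤ κ) (hκ : κ < 1) (hκρ : κ < ρ) {K : ℝ}
    (ht : 2 * (K - 1) * zetaWeights q < 0) : datumOf (dial q K zetaWeights) ∉ ModulusRatioClassFar amin κ := by
  obtain ⟨W, hW⟩ := h.exists_clusterBindersNegLight
  exact downDial_not_mem_modulusRatioClassFar hW.toClusterBindersNeg hamin hκ0 hκ (by linarith) ht

/-- PROVED: modulus, both packages ⇒ trivial dial. [folklore] -/
theorem dial_mem_modulusRatioClassFar_imp_trivial_of_clusterReady {q : ℕ} {ρ ρ' : ℝ} (h : ClusterReady q ρ)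
    (h' : ClusterReadyNeg q ρ') {amin : ℝ} (hamin : amin ≤ Real.log q / 2) {κ : ℝ} (hκ0 : 0 ≤ κ) (hκ : κ < 1)
    (hκρ : κ < ρ) (hκρ' : κ < ρ') {K : ℝ} (hmem : datumOf (dial q K zetaWeights) ∈ ModulusRatioClassFar amin κ) :
    (K - 1) * zetaWeights q = 0 := by
  by_contra hne
  rcases lt_or_gt_of_ne hne with hlt | hgt
  · exact downDial_not_mem_modulusRatioClassFar_of_clusterReadyNeg h' hamin hκ0 hκ hκρ' (K := K) (by linarith) hmem
  · exact upDial_not_mem_modulusRatioClassFar_of_clusterReady h hamin hκ0 hκ hκρ (K := K) (by linarith) hmem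

/-- PROVED: for the floor of record `3/10` the reach hypothesis is automatic for every prime. [folklore] -/
theorem upDial_not_mem_gaugeRatioClassFar_three_tenths_of_clusterReady {q : ℕ} (hq : 2 ≤ q) {ρ : ℝ}
    (h : ClusterReady q ρ) {τ : ℝ} (hτ0 : 0 ≤ τ) (hτ : τ < 1) (hτρ : τ * (1 + ρ) < ρ) {K : ℝ}
    (ht : 0 < 2 * (K - 1) * zetaWeights q) : datumOf (dial q K zetaWeights) ∉ GaugeRatioClassFar (3 / 10) τ :=
  upDial_not_mem_gaugeRatioClassFar_of_clusterReady h (three_tenths_le_half_log hq) hτ0 hτ hτρ ht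

/-! ## §4 Soundness and the zero-side reading transfer to far windows -/

/-- PROVED: a separating sub-class of a far-guarded class puts `ζ` in the class. [folklore] -/
theorem zeta_mem_gaugeRatioClassFar_of_separates {S D : Set Datum} {amin τ : ℝ} (hS : S ⊆ GaugeRatioClassFar amin τ)
    (hsep : Separates S D zetaDatum) : zetaDatum ∈ GaugeRatioClassFar amin τ :=
  hS hsep.1

/-- **PROVED — THE FAR-GUARDED PREMISE'S ONLY FAILURE MODE**: ONE far window (`a_min ≤ a`) where `ζ` carries a
plane of height `≤ η₂` and a direction more than `m`-negative with `τη₂ < m(1 − τ)` refutes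
`ζ ∈ GaugeRatioClassFar a_min τ`. [folklore] -/
theorem zeta_not_mem_gaugeRatioClassFar_of_deep_negative {amin τ : ℝ} {win : Window} (hwin : amin ≤ win.a)
    {x y : Fin (win.N + 1) → ℝ} (hx : x ≠ 0) (hy : y ≠ 0) (hxy : y ⬝ᵥ x = 0) {η₂ : ℝ}
    (hZ : ∀ α β : ℝ, (α • x + β • y) ⬝ᵥ (zetaDatum win *ᵥ (α • x + β • y))
      ≤ η₂ * ((α • x + β • y) ⬝ᵥ (α • x + β • y)))
    {v : Fin (win.N + 1) → ℝ} (hv : v ≠ 0) {m : ℝ} (hm : 0 < m)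
    (hneg : v ⬝ᵥ (zetaDatum win *ᵥ v) ≤ -m * (v ⬝ᵥ v)) (hτ0 : 0 ≤ τ) (hτ : τ < 1)
    (hdeep : τ * η₂ < m * (1 - τ)) : zetaDatum ∉ GaugeRatioClassFar amin τ := fun h =>
  zeta_not_mem_gaugeRatioAt_of_deep_negative hx hy hxy hZ hv hm hneg hτ0 hτ hdeep
    (h win hwin (pos_of_orth_pair hx hy hxy))

/-- **PROVED — NON-NEGATIVE SECOND LEVEL AT FAR WINDOWS ALREADY GIVES THE ZERO-SIDE READING**: the Galerkin
negative-index readings need only LONG windows, so a window floor costs nothing. RH-free; premise NOT asserted.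
[folklore] -/
theorem quadrant_infinite_or_encard_le_one_of_secondRayleigh_nonneg_far {amin : ℝ}
    (h : ∀ win : Window, amin ≤ win.a → 0 < win.N → 0 ≤ secondRayleigh (zetaDatum win)) :
    {ρ : ℂ | ρ ∈ riemannZetaNontrivialZeros ∧ 1 / 2 < ρ.re ∧ 0 < ρ.im}.Infinite ∨
      {ρ : ℂ | ρ ∈ riemannZetaNontrivialZeros ∧ 1 / 2 < ρ.re ∧ 0 < ρ.im}.encard ≤ 1 :=
  quadrant_infinite_or_encard_le_one fun a ha2 ↦ by
    have hpos : 0 < max a (max amin 1) := lt_max_of_lt_right (lt_max_of_lt_right one_pos)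
    obtain ⟨N₀, hN₀⟩ :=
      eventually_secondRayleigh_neg_of_evenNegIndexAtLeast_two hpos (ha2.mono (le_max_left _ _))
    exact absurd (hN₀ (N₀ + 1) (Nat.le_succ _)) (not_lt.2 (h ⟨max a (max amin 1), N₀ + 1, hpos⟩
      ((le_max_left _ _).trans (le_max_right _ _)) (Nat.succ_pos _)))

/-- PROVED: finitely many off-line zeros and `ε₂(ζ; w) ≥ 0` at every far window leave at most one off-line
quadruple. [folklore] -/
theorem card_le_one_of_secondRayleigh_nonneg_far {amin : ℝ}
    (hfin : {ρ : ℂ | ρ ∈ riemannZetaNontrivialZeros ∧ 1 / 2 < ρ.re ∧ 0 < ρ.im}.Finite)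
    (h : ∀ win : Window, amin ≤ win.a → 0 < win.N → 0 ≤ secondRayleigh (zetaDatum win)) :
    hfin.toFinset.card ≤ 1 := by
  by_contra hlt
  obtain ⟨A, hA0, hA⟩ := exists_secondRayleigh_neg_of_two_le_card hfin (by omega)
  obtain ⟨N₀, hN₀⟩ := hA (max A amin + 1) (by linarith [le_max_left A amin])
  exact absurd (hN₀ (N₀ + 1) (Nat.le_succ _))
    (not_lt.2 (h ⟨max A amin + 1, N₀ + 1, _⟩ (by show amin ≤ max A amin + 1; linarith [le_max_right A amin])
      (Nat.succ_pos _)))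

/-- PROVED: `ζ ∈ GaugeRatioClassFar a_min τ` (`0 ≤ τ < 1`) ⇒ `ε₂(ζ; w) ≥ 0` at every far window of dimension
`≥ 2`. [folklore] -/
theorem zeta_secondRayleigh_nonneg_far_of_mem_gaugeRatioClassFar {amin τ : ℝ} (hτ0 : 0 ≤ τ) (hτ : τ < 1)
    (h : zetaDatum ∈ GaugeRatioClassFar amin τ) :
    ∀ win : Window, amin ≤ win.a → 0 < win.N → 0 ≤ secondRayleigh (zetaDatum win) :=
  fun win hwin hN => secondRayleigh_nonneg_of_mem_gaugeRatioAt hN hτ0 hτ (h win hwin hN)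

/-- PROVED: modulus twin. [folklore] -/
theorem zeta_secondRayleigh_nonneg_far_of_mem_modulusRatioClassFar {amin κ : ℝ} (hκ0 : 0 ≤ κ) (hκ : κ < 1)
    (h : zetaDatum ∈ ModulusRatioClassFar amin κ) :
    ∀ win : Window, amin ≤ win.a → 0 < win.N → 0 ≤ secondRayleigh (zetaDatum win) :=
  fun win hwin hN => secondRayleigh_nonneg_of_mem_modulusRatioAt hN hκ0 hκ (h win hwin hN)

/-- **PROVED — ZERO-SIDE READING FROM THE FAR-GUARDED PREMISE (gauge)**: `ζ ∈ GaugeRatioClassFar a_min τ`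
(`0 ≤ τ < 1`, ANY floor) ⇒ the off-line zero quadrant is infinite or has at most one element. RH-free; premise NOT
asserted; conclusion implied by RH and not known to imply it. [folklore] -/
theorem quadrant_infinite_or_encard_le_one_of_zeta_mem_gaugeRatioClassFar {amin τ : ℝ} (hτ0 : 0 ≤ τ)
    (hτ : τ < 1) (h : zetaDatum ∈ GaugeRatioClassFar amin τ) :
    {ρ : ℂ | ρ ∈ riemannZetaNontrivialZeros ∧ 1 / 2 < ρ.re ∧ 0 < ρ.im}.Infinite ∨
      {ρ : ℂ | ρ ∈ riemannZetaNontrivialZeros ∧ 1 / 2 < ρ.re ∧ 0 < ρ.im}.encard ≤ 1 :=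
  quadrant_infinite_or_encard_le_one_of_secondRayleigh_nonneg_far
    (zeta_secondRayleigh_nonneg_far_of_mem_gaugeRatioClassFar hτ0 hτ h)

/-- PROVED: modulus twin. [folklore] -/
theorem quadrant_infinite_or_encard_le_one_of_zeta_mem_modulusRatioClassFar {amin κ : ℝ} (hκ0 : 0 ≤ κ)
    (hκ : κ < 1) (h : zetaDatum ∈ ModulusRatioClassFar amin κ) :
    {ρ : ℂ | ρ ∈ riemannZetaNontrivialZeros ∧ 1 / 2 < ρ.re ∧ 0 < ρ.im}.Infinite ∨
      {ρ : ℂ | ρ ∈ riemannZetaNontrivialZeros ∧ 1 / 2 < ρ.re ∧ 0 < ρ.im}.encard ≤ 1 :=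
  quadrant_infinite_or_encard_le_one_of_secondRayleigh_nonneg_far
    (zeta_secondRayleigh_nonneg_far_of_mem_modulusRatioClassFar hκ0 hκ h)

/-- PROVED: two or more (finitely many) off-line quadruples exclude `ζ` from every far-guarded gauge class
(`0 ≤ τ < 1`). [folklore] -/
theorem zeta_not_mem_gaugeRatioClassFar_of_two_le_card {amin τ : ℝ} (hτ0 : 0 ≤ τ) (hτ : τ < 1)
    (hfin : {ρ : ℂ | ρ ∈ riemannZetaNontrivialZeros ∧ 1 / 2 < ρ.re ∧ 0 < ρ.im}.Finite)
    (h2 : 2 ≤ hfin.toFinset.card) : zetaDatum ∉ GaugeRatioClassFar amin τ := fun h => by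
  have := card_le_one_of_secondRayleigh_nonneg_far hfin
    (zeta_secondRayleigh_nonneg_far_of_mem_gaugeRatioClassFar hτ0 hτ h)
  omega

/-- PROVED: modulus twin. [folklore] -/
theorem zeta_not_mem_modulusRatioClassFar_of_two_le_card {amin κ : ℝ} (hκ0 : 0 ≤ κ) (hκ : κ < 1)
    (hfin : {ρ : ℂ | ρ ∈ riemannZetaNontrivialZeros ∧ 1 / 2 < ρ.re ∧ 0 < ρ.im}.Finite)
    (h2 : 2 ≤ hfin.toFinset.card) : zetaDatum ∉ ModulusRatioClassFar amin κ := fun h => by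
  have := card_le_one_of_secondRayleigh_nonneg_far hfin
    (zeta_secondRayleigh_nonneg_far_of_mem_modulusRatioClassFar hκ0 hκ h)
  omega

/-- **PROVED — A SEPARATING FAR-GUARDED GAUGE READER READS THE ZERO SIDE**: if some `S ⊆ GaugeRatioClassFar
a_min τ` (`0 ≤ τ < 1`) separates `ζ` over any domain, the off-line quadrant is infinite or has at most one element.
[folklore] -/
theorem quadrant_infinite_or_encard_le_one_of_separates_gaugeRatioFar {S D : Set Datum} {amin τ : ℝ}
    (hS : S ⊆ GaugeRatioClassFar amin τ) (hτ0 : 0 ≤ τ) (hτ : τ < 1) (hsep : Separates S D zetaDatum) :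
    {ρ : ℂ | ρ ∈ riemannZetaNontrivialZeros ∧ 1 / 2 < ρ.re ∧ 0 < ρ.im}.Infinite ∨
      {ρ : ℂ | ρ ∈ riemannZetaNontrivialZeros ∧ 1 / 2 < ρ.re ∧ 0 < ρ.im}.encard ≤ 1 :=
  quadrant_infinite_or_encard_le_one_of_zeta_mem_gaugeRatioClassFar hτ0 hτ (hS hsep.1)

/-- PROVED: modulus twin. [folklore] -/
theorem quadrant_infinite_or_encard_le_one_of_separates_modulusRatioFar {S D : Set Datum} {amin κ : ℝ}
    (hS : S ⊆ ModulusRatioClassFar amin κ) (hκ0 : 0 ≤ κ) (hκ : κ < 1) (hsep : Separates S D zetaDatum) :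
    {ρ : ℂ | ρ ∈ riemannZetaNontrivialZeros ∧ 1 / 2 < ρ.re ∧ 0 < ρ.im}.Infinite ∨
      {ρ : ℂ | ρ ∈ riemannZetaNontrivialZeros ∧ 1 / 2 < ρ.re ∧ 0 < ρ.im}.encard ≤ 1 :=
  quadrant_infinite_or_encard_le_one_of_zeta_mem_modulusRatioClassFar hκ0 hκ (hS hsep.1)

end Summit.RiemannHypothesis.RiemannHypothesis.Theorems.PfPersistence

end
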